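import Summits.CriticalPhenomena.PercolationContinuityZ3.Theorems.PercNearOneGluingNoHeavyLowerTailSahiGridPatternKernel

/-!
# `NoHeavyLowerTail` (crux stmt-CriticalPhenomena-4575), Sahi programme: **RESTRICTION TO A BLOCK — cylinder triples reduce to the block, EVERY DIMENSION**
# (`sStarD A B C = 6^{d−|J|} · sStarD A_J B_J C_J` for `J`-measurable `A, B, C`); hence triples measurable w.r.t. `≤ 3` common coordinates are good (kernel)

Support file (seat `prim-sahi-p1`, generation 10; `--supports stmt-CriticalPhenomena-4575`).  Pure proofs, no definitions, no `sorry`, standard axioms.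
Vocabulary of `…SahiGridPattern` (`Pd`, `sStarD`, `col`, `hZ`, `ind`, `PatternPos`, `patternPos_of_le`) and `…SahiGridPatternKernel` (`sStarD_three_nonneg` = kernel `PatternPos 3`).

THE MATHEMATICS.  `J ⊆ [d]` a block, `k = |J|`, `e = J.equivFin : J ≃ Fin k`.  For `x ∈ [3]^k` let `ext x ∈ [3]^d` be `x` transported to the `J`-coordinates and `0`
elsewhere, and for `X ⊆ [3]^d` let `X_J := {x ∈ [3]^k : ext x ∈ X}` (the block restriction).  If `X` is `J`-MEASURABLE (membership depends only on the `J`-coordinates)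
then `x' ∈ X ↔ (x'|_J read through e) ∈ X_J`.
* `sStarD_eq_pow_mul_restrict` (every `d`, `J`): for `J`-measurable `A, B, C ⊆ [3]^d`, **`sStarD A B C = 6^{d−k} · sStarD A_J B_J C_J`** — a Latin triple of `[3]^d` restricts to
  one of `[3]^k` on the block, each arising from `6^{d−k}` Latin triples (`card_fibre_restrict`), and the kernel `h` only reads the block.
* `isUpperSet_restrict`: restrictions of up-sets are up-sets.
* **`sStarD_measurable_nonneg_of_patternPos`**: `PatternPos |J| ⟹` every `J`-measurable up-set triple of `[3]^d` is good; unconditionally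
  **`sStarD_measurable_nonneg_of_card_le_three`**: if the up-sets `A, B, C ⊆ [3]^d` are all measurable w.r.t. a common set of `≤ 3` coordinates then
  `0 ≤ sStarD A B C`, every `d` (kernel `PatternPos 3`, `sStarD_three_nonneg`).  These discharge the 'cylinder triple is good' hypotheses of
  `…SahiGridPatternBlockProduct` (`sStarD_nonneg_of_blockProduct`) and `…SahiGridPatternTwoCylinders` (`sStarD_nonneg_of_twoCylinders`) on blocks of `≤ 3`
  axes (and of `4` axes once `PatternPos 4` is available as a term).
HONEST LABEL: bookkeeping + the settled `PatternPos ≤ 3`; `PatternPos d` (`d ≥ 4` kernel / `≥ 5` at all), Sahi's `C₃` and Kahn's conjecture remain OPEN. [this work]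
-/

noncomputable section

open Finset
open scoped Classical

namespace Summit.CriticalPhenomena.PercolationContinuityZ3.Theorems.SahiGridPattern

open SahiGrid3 (ind hZ)

variable {d : ℕ}

/-! ### Restriction of Latin triples to a block and the fibre count -/

/-- **Each Latin triple of the block comes from exactly `6^{d−|J|}` Latin triples of `[3]^d`.** [this work] -/
theorem card_fibre_restrict (J : Finset (Fin d)) (ρ : Fin J.card → Equiv.Perm (Fin 3)) :
    (univ.filter fun π : Fin d → Equiv.Perm (Fin 3) => (fun i : Fin J.card => π (J.equivFin.symm i).1) = ρ).card = 6 ^ (d - J.card) := by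
  have e : (univ.filter fun π : Fin d → Equiv.Perm (Fin 3) => (fun i : Fin J.card => π (J.equivFin.symm i).1) = ρ) =
      Fintype.piFinset fun a : Fin d => if h : a ∈ J then ({ρ (J.equivFin ⟨a, h⟩)} : Finset (Equiv.Perm (Fin 3))) else univ := by
    ext π
    simp only [Finset.mem_filter, Finset.mem_univ, true_and, Fintype.mem_piFinset]
    constructor
    · intro h a
      by_cases ha : a ∈ J
      · rw [dif_pos ha, Finset.mem_singleton, ← h]
        show π a = π (J.equivFin.symm (J.equivFin ⟨a, ha⟩)).1
        rw [Equiv.symm_apply_apply]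
      · rw [dif_neg ha]; exact Finset.mem_univ _
    · intro h
      funext i
      have hi := h (J.equivFin.symm i).1
      rw [dif_pos (J.equivFin.symm i).2, Finset.mem_singleton] at hi
      rw [hi, Subtype.coe_eta, Equiv.apply_symm_apply]
  rw [e, Fintype.card_piFinset]
  have hcard : ∀ a : Fin d, (if h : a ∈ J then ({ρ (J.equivFin ⟨a, h⟩)} : Finset (Equiv.Perm (Fin 3))) else univ).card = if a ∈ J then 1 else 6 := by
    intro a
    by_cases ha : a ∈ J
    · rw [dif_pos ha, if_pos ha, Finset.card_singleton]
    · rw [dif_neg ha, if_neg ha, Finset.card_univ, Fintype.card_perm, Fintype.card_fin]; rfl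
  rw [Finset.prod_congr rfl fun a _ => hcard a, Finset.prod_ite, Finset.prod_const_one, one_mul, Finset.prod_const]
  congr 1
  rw [Finset.filter_not, Finset.filter_mem_eq_inter, Finset.univ_inter, Finset.card_univ_sdiff, Fintype.card_fin]

/-- A column of a Latin triple agrees on `J` with the extension of the corresponding column of its restriction. [this work] -/
theorem ext_col_restrict (J : Finset (Fin d)) (π : Fin d → Equiv.Perm (Fin 3)) (c : Fin 3) :
    ∀ a ∈ J, (fun a : Fin d => if h : a ∈ J then col (fun i : Fin J.card => π (J.equivFin.symm i).1) c (J.equivFin ⟨a, h⟩) else (0 : Fin 3)) a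
      = col π c a := by
  intro a ha
  simp only [ha, dif_pos, col]
  show π (J.equivFin.symm (J.equivFin ⟨a, ha⟩)).1 c = π a c
  rw [Equiv.symm_apply_apply]

/-- Indicator of a `J`-measurable set at a column = indicator of its restriction at the restricted column. [this work] -/
theorem ind_col_eq_ind_restrict (J : Finset (Fin d)) {X : Finset (Pd d)} (hX : ∀ x y : Pd d, (∀ a ∈ J, x a = y a) → (x ∈ X ↔ y ∈ X))
    (π : Fin d → Equiv.Perm (Fin 3)) (c : Fin 3) :
    ind X (col π c) = ind (univ.filter fun x : Pd J.card =>
      (fun a : Fin d => if h : a ∈ J then x (J.equivFin ⟨a, h⟩) else (0 : Fin 3)) ∈ X) (col (fun i : Fin J.card => π (J.equivFin.symm i).1) c) := by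
  unfold ind
  refine if_congr ?_ rfl rfl
  rw [Finset.mem_filter]
  simp only [Finset.mem_univ, true_and]
  exact (hX _ _ (ext_col_restrict J π c)).symm

/-- **Restriction to a block**: for `J`-measurable `A, B, C ⊆ [3]^d`, `sStarD A B C = 6^{d−|J|} · sStarD A_J B_J C_J`. [this work] -/
theorem sStarD_eq_pow_mul_restrict (J : Finset (Fin d)) {A B C : Finset (Pd d)}
    (hA : ∀ x y : Pd d, (∀ a ∈ J, x a = y a) → (x ∈ A ↔ y ∈ A)) (hB : ∀ x y : Pd d, (∀ a ∈ J, x a = y a) → (x ∈ B ↔ y ∈ B))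
    (hC : ∀ x y : Pd d, (∀ a ∈ J, x a = y a) → (x ∈ C ↔ y ∈ C)) :
    sStarD A B C = 6 ^ (d - J.card) *
      sStarD (univ.filter fun x : Pd J.card => (fun a : Fin d => if h : a ∈ J then x (J.equivFin ⟨a, h⟩) else (0 : Fin 3)) ∈ A)
        (univ.filter fun x : Pd J.card => (fun a : Fin d => if h : a ∈ J then x (J.equivFin ⟨a, h⟩) else (0 : Fin 3)) ∈ B)
        (univ.filter fun x : Pd J.card => (fun a : Fin d => if h : a ∈ J then x (J.equivFin ⟨a, h⟩) else (0 : Fin 3)) ∈ C) := by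
  set A' := (univ.filter fun x : Pd J.card => (fun a : Fin d => if h : a ∈ J then x (J.equivFin ⟨a, h⟩) else (0 : Fin 3)) ∈ A) with hA'
  set B' := (univ.filter fun x : Pd J.card => (fun a : Fin d => if h : a ∈ J then x (J.equivFin ⟨a, h⟩) else (0 : Fin 3)) ∈ B) with hB'
  set C' := (univ.filter fun x : Pd J.card => (fun a : Fin d => if h : a ∈ J then x (J.equivFin ⟨a, h⟩) else (0 : Fin 3)) ∈ C) with hC'
  let R : (Fin d → Equiv.Perm (Fin 3)) → (Fin J.card → Equiv.Perm (Fin 3)) := fun π i => π (J.equivFin.symm i).1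
  have hker : ∀ π : Fin d → Equiv.Perm (Fin 3),
      hZ A B C (col π 0) (col π 1) (col π 2) = hZ A' B' C' (col (R π) 0) (col (R π) 1) (col (R π) 2) := by
    intro π
    unfold hZ
    rw [ind_col_eq_ind_restrict J hA π 0, ind_col_eq_ind_restrict J hA π 1, ind_col_eq_ind_restrict J hB π 0, ind_col_eq_ind_restrict J hB π 1,
      ind_col_eq_ind_restrict J hC π 0, ind_col_eq_ind_restrict J hC π 1, ind_col_eq_ind_restrict J hC π 2]
  unfold sStarD
  rw [Finset.sum_congr rfl fun π _ => hker π,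
    ← Finset.sum_fiberwise univ R (fun π => hZ A' B' C' (col (R π) 0) (col (R π) 1) (col (R π) 2)), Finset.mul_sum]
  refine Finset.sum_congr rfl fun ρ _ => ?_
  rw [Finset.sum_congr rfl fun π hπ => by rw [(Finset.mem_filter.1 hπ).2], Finset.sum_const, card_fibre_restrict J ρ, nsmul_eq_mul]
  push_cast
  ring

/-- The restriction of an up-set to a block is an up-set. [this work] -/
theorem isUpperSet_restrict (J : Finset (Fin d)) {X : Finset (Pd d)} (hX : IsUpperSet (X : Set (Pd d))) :
    IsUpperSet ((univ.filter fun x : Pd J.card => (fun a : Fin d => if h : a ∈ J then x (J.equivFin ⟨a, h⟩) else (0 : Fin 3)) ∈ X) : Set (Pd J.card)) := by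
  intro x y hxy hx
  rw [Finset.mem_coe, Finset.mem_filter] at hx ⊢
  refine ⟨Finset.mem_univ _, hX (fun a => ?_) hx.2⟩
  by_cases ha : a ∈ J
  · simp only [ha, dif_pos]; exact hxy _
  · simp only [ha, dif_neg, not_false_eq_true, le_refl]

/-! ### Consequences -/

/-- **`PatternPos |J|` ⟹ every `J`-measurable up-set triple of `[3]^d` is good** (every `d`). [this work] -/
theorem sStarD_measurable_nonneg_of_patternPos (J : Finset (Fin d)) (hP : PatternPos J.card) {A B C : Finset (Pd d)}
    (hAu : IsUpperSet (A : Set (Pd d))) (hBu : IsUpperSet (B : Set (Pd d))) (hCu : IsUpperSet (C : Set (Pd d)))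
    (hA : ∀ x y : Pd d, (∀ a ∈ J, x a = y a) → (x ∈ A ↔ y ∈ A)) (hB : ∀ x y : Pd d, (∀ a ∈ J, x a = y a) → (x ∈ B ↔ y ∈ B))
    (hC : ∀ x y : Pd d, (∀ a ∈ J, x a = y a) → (x ∈ C ↔ y ∈ C)) : 0 ≤ sStarD A B C := by
  rw [sStarD_eq_pow_mul_restrict J hA hB hC]
  exact mul_nonneg (by positivity) (hP _ _ _ (isUpperSet_restrict J hAu) (isUpperSet_restrict J hBu) (isUpperSet_restrict J hCu))

/-- **Up-set triples measurable w.r.t. a common set of at most three coordinates are good, every dimension** (kernel `PatternPos 3`). [this work] -/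
theorem sStarD_measurable_nonneg_of_card_le_three (J : Finset (Fin d)) (hJ : J.card ≤ 3) {A B C : Finset (Pd d)}
    (hAu : IsUpperSet (A : Set (Pd d))) (hBu : IsUpperSet (B : Set (Pd d))) (hCu : IsUpperSet (C : Set (Pd d)))
    (hA : ∀ x y : Pd d, (∀ a ∈ J, x a = y a) → (x ∈ A ↔ y ∈ A)) (hB : ∀ x y : Pd d, (∀ a ∈ J, x a = y a) → (x ∈ B ↔ y ∈ B))
    (hC : ∀ x y : Pd d, (∀ a ∈ J, x a = y a) → (x ∈ C ↔ y ∈ C)) : 0 ≤ sStarD A B C :=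
  sStarD_measurable_nonneg_of_patternPos J (patternPos_of_le hJ fun X Y Z hX hY hZ => sStarD_three_nonneg X Y Z hX hY hZ) hAu hBu hCu hA hB hC

end Summit.CriticalPhenomena.PercolationContinuityZ3.Theorems.SahiGridPattern
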